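import Literature.Geometry.Kaehler.RiemannSurfacePeriodPairing
import Literature.Geometry.Kaehler.RiemannSurfaceJacobianTorus
import Literature.Geometry.Kaehler.RiemannSurfaceAbelJacobiIsomorphism
import Literature.Geometry.Kaehler.ComplexTorusFactorAlternatingFormExtension
import HarnessLib

/-!
# The canonical polarization of the Jacobian: `Jac(M) = ℂ^g/Π ℤ^{2g}` is an abelian variety
# (Lange, *Abelian Varieties over the Complex Numbers*, §4.1.2 Proposition 4.1.2; Forster §21.7)

Layer `Literature/Geometry/Kaehler`, sequel of `RiemannSurfacePeriodPairing` (for every loop `γ` a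
holomorphic `η_γ` with `∬ θ ∧ η̄_γ = -(C/2) ∫_γ θ` and `2 Re ∫_δ η_γ ∈ ℤ`), `RiemannSurfaceJacobianTorus`
(`Jac(M) ≃+ ComplexTorus (periodMatrix x₀ w c)`, the period matrix `Π : ℝ^{2g} ≃ ℂ^g` of a basis
`w` of `Ω(M)` and a `ℤ`-basis `c` of the period lattice) and the lane's `ComplexTorus.IsRiemannForm`
/ `IsAbelianVariety` (`ComplexTorusSubvarieties`).

H. Lange, *Abelian Varieties over the Complex Numbers* (2023), §4.1.2: «on `H⁰(ω_C)^*` there is a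
canonical Hermitian form `H` … whose imaginary part is integral on `H₁(C, ℤ)` … `(J(C), H)` is a
principally polarized abelian variety» (Proposition 4.1.2; the classical Riemann bilinear relations,
Forster §21.7, Griffiths–Harris pp. 231–232).  Here the POLARIZATION (positivity, type `(1,1)`,
integrality on the lattice) is obtained; principality (unimodularity on `H₁`) is not addressed.

* §1 algebra of the pairing `holPairing θ ζ = ∬ θ dz ∧ ζ̄ dz̄` of `RiemannSurfacePeriodPairing`:
  sesquilinearity, the skew-Hermitian symmetry `⟪ζ, θ⟫ = -conj ⟪θ, ζ⟫`, and Riemann's inequality in the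
  form `Im ⟪θ, θ⟫ < 0` for `θ ≠ 0` (`im_holPairing_self_neg`);
* §2 the conjugate-linear **Riesz isomorphism** `Ω(M) ≃ ℂ^g`, `ζ ↦ (⟪w_j, ζ⟫)_j` (`pairingEquiv`;
  injective by Riemann's inequality, bijective by the dimension count `dim_ℝ Ω = 2g = dim_ℝ ℂ^g`) and
  its inverse `omegaOf` (`holPairing_omegaOf : ⟪θ, ω_z⟫ = (dualCoords w)⁻¹ z θ`);
* §3 **the Riemann form** `E(z, z') = C · Re ⟪ω_{z'}, ω_z⟫` on `ℂ^g` (`jacobianRiemannForm`): it is of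
  type `(1,1)`, positive (`E(iz, z) = -C · Im ⟪ω_z, ω_z⟫ > 0`), and INTEGRAL on the period lattice:
  `ω_{∫_γ} = -(2/C) η_γ`, so `E(∫_γ, ∫_δ) = -2 Re ∫_γ η_δ ∈ ℤ` (**`isRiemannForm_jacobianRiemannForm`**),
  whence **`isAbelianVariety_jacobian : IsAbelianVariety (periodMatrix x₀ w c)`** — the Jacobian of a
  compact connected Riemann surface is an abelian variety.

* §4 corollaries: `Pic⁰(M)` is the group of points of an abelian variety
  (`exists_kerDegree_addEquiv_abelianVariety`, via the Abel–Jacobi isomorphism), and **Riemann's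
  bilinear relation for the loop differentials**: `∫_δ η_γ = -conj ∫_γ η_δ`
  (`period_eq_neg_conj_period_of_holPairing_eq`).

Everything is proved; no named facts, no instances.

## References

* H. Lange, *Abelian Varieties over the Complex Numbers*, Grundlehren Text Editions, Springer (2023),
  §4.1.2 Proposition 4.1.2 and §2.1 (Riemann forms). [Lange2023AbelianVarietiesComplex]
* O. Forster, *Lectures on Riemann Surfaces*, GTM 81 (1981), §19.5, §21.7. [Forster1981]
* R. Miranda, *Algebraic Curves and Riemann Surfaces*, GSM 5 (1995), Chapter VIII §4. [Miranda1995]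
-/

noncomputable section

open scoped Manifold ContDiff Topology ComplexConjugate Real
open Set Filter Function Complex
open Literature.NumberTheory.Transcendental Literature.Analysis.Complex Literature.Topology.CoveringSpaces
open Literature.AlgebraicGeometry.Motives (cintegral re_cintegral im_cintegral)

namespace Literature.Geometry.Kaehler

namespace RiemannSurface

open MeromorphicOneForm ComplexTorus

universe u

variable {M : Type u} [TopologicalSpace M] [ChartedSpace ℂ M]

/-! ### §1 Algebra of the pairing -/

section PairingAlgebra

variable [IsManifold 𝓘(ℂ, ℂ) ω M] [IsManifold 𝓘(ℝ, ℂ) ∞ M] [CompactSpace M] [T2Space M]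
  [Fact (Module.finrank ℝ ℂ = 2)]

/-- Homogeneity of `∬` on smooth complex `2`-forms (complex scalars). [cite: Forster1981, §19.5] -/
theorem cintegral_smul_of_isSmoothForm (c : ℂ) {α : MForm 𝓘(ℝ, ℂ) M ℂ 2} (hα : IsSmoothForm α) :
    cintegral (fun _ : M ↦ Complex.orientation) (c • α) = c * cintegral (fun _ : M ↦ Complex.orientation) α := by
  have ho := isContinuousOrientation_complex (M := M)
  have hre : MForm.integral (fun _ : M ↦ Complex.orientation) (c • α).re =
      c.re * MForm.integral (fun _ : M ↦ Complex.orientation) α.re -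
        c.im * MForm.integral (fun _ : M ↦ Complex.orientation) α.im := by
    rw [MForm.re_smul, sub_eq_add_neg, ← neg_one_smul ℝ (c.im • α.im),
      MForm.integral_add_holds (o := fun _ : M ↦ Complex.orientation) ho (hα.re.smul c.re)
        ((hα.im.smul c.im).smul (-1)),
      MForm.integral_smul, MForm.integral_smul, MForm.integral_smul]
    ring
  have him : MForm.integral (fun _ : M ↦ Complex.orientation) (c • α).im =
      c.re * MForm.integral (fun _ : M ↦ Complex.orientation) α.im +
        c.im * MForm.integral (fun _ : M ↦ Complex.orientation) α.re := by
    rw [MForm.im_smul, MForm.integral_add_holds (o := fun _ : M ↦ Complex.orientation) ho (hα.im.smul c.re)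
      (hα.re.smul c.im), MForm.integral_smul, MForm.integral_smul]
  apply Complex.ext
  · rw [re_cintegral, hre, Complex.mul_re, re_cintegral, im_cintegral]
  · rw [im_cintegral, him, Complex.mul_im, re_cintegral, im_cintegral]

omit [IsManifold 𝓘(ℂ, ℂ) ω M] in
/-- `∬ (-α) = -∬ α`. [cite: Forster1981, §19.5] -/
theorem cintegral_neg (α : MForm 𝓘(ℝ, ℂ) M ℂ 2) :
    cintegral (fun _ : M ↦ Complex.orientation) (-α) = -cintegral (fun _ : M ↦ Complex.orientation) α := by
  have hre : (-α).re = (-1 : ℝ) • α.re := by funext x; ext v; simp [MForm.re_apply]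
  have him : (-α).im = (-1 : ℝ) • α.im := by funext x; ext v; simp [MForm.im_apply]
  apply Complex.ext
  · rw [re_cintegral, hre, MForm.integral_smul, Complex.neg_re, re_cintegral]; ring
  · rw [im_cintegral, him, MForm.integral_smul, Complex.neg_im, im_cintegral]; ring

omit [IsManifold 𝓘(ℂ, ℂ) ω M] in
/-- `∬ ᾱ = conj ∬ α`. [cite: Forster1981, §19.5] -/
theorem cintegral_conj (α : MForm 𝓘(ℝ, ℂ) M ℂ 2) :
    cintegral (fun _ : M ↦ Complex.orientation) α.conj = conj (cintegral (fun _ : M ↦ Complex.orientation) α) := by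
  have hre : α.conj.re = α.re := by funext x; ext v; simp [MForm.re_apply]
  have him : α.conj.im = (-1 : ℝ) • α.im := by funext x; ext v; simp [MForm.im_apply]
  apply Complex.ext
  · rw [re_cintegral, hre, Complex.conj_re, re_cintegral]
  · rw [im_cintegral, him, MForm.integral_smul, Complex.conj_im, im_cintegral]; ring

omit [IsManifold 𝓘(ℂ, ℂ) ω M] [IsManifold 𝓘(ℝ, ℂ) ∞ M] [CompactSpace M] [T2Space M]
  [Fact (Module.finrank ℝ ℂ = 2)] in
/-- `f̄ dz ∧ dz̄ = -conj(f dz ∧ dz̄)` (`conj(dz ∧ dz̄) = dz̄ ∧ dz = -dz ∧ dz̄`). [cite: Forster1981, §19.5] -/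
theorem oneOneForm_star (f : M → ℂ) : oneOneForm (star f) = -(oneOneForm f).conj := by
  funext x
  ext v
  simp only [oneOneForm_apply, Pi.star_apply, RCLike.star_def, Pi.neg_apply,
    ContinuousAlternatingMap.neg_apply, MForm.conj_apply, map_mul, map_sub, Complex.conj_conj]
  ring

omit [IsManifold 𝓘(ℂ, ℂ) ω M] in
/-- `⟪θ, ζ⟫ = ∬ θ ζ̄ dz ∧ dz̄`. [cite: Forster1981, §19.5] -/
theorem holPairing_eq_cintegral_oneOneForm (θ ζ : MeromorphicOneForm M) :
    holPairing θ ζ = cintegral (fun _ : M ↦ Complex.orientation) (oneOneForm (⇑θ * star ⇑ζ)) := by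
  rw [holPairing_def, oneZeroForm_wedge_zeroOneForm]

omit [CompactSpace M] [T2Space M] [Fact (Module.finrank ℝ ℂ = 2)] in
/-- `θ ζ̄ dz ∧ dz̄` is smooth for holomorphic `θ, ζ`. [cite: Forster1981, §19.5] -/
theorem isSmoothForm_oneOneForm_mul_star {θ ζ : MeromorphicOneForm M} (hθ : θ.IsHolomorphic)
    (hζ : ζ.IsHolomorphic) : IsSmoothForm (oneOneForm (⇑θ * star ⇑ζ)) := by
  rw [← oneZeroForm_wedge_zeroOneForm]
  exact IsSmoothFormWedge_holds 𝓘(ℝ, ℂ) M ℂ hθ.isSmoothForm_oneZeroForm hζ.isSmoothForm_zeroOneForm_star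

omit [IsManifold 𝓘(ℂ, ℂ) ω M] in
/-- **Skew-Hermitian symmetry**: `⟪ζ, θ⟫ = -conj ⟪θ, ζ⟫`. [cite: Forster1981, §19.5] -/
theorem holPairing_swap (θ ζ : MeromorphicOneForm M) : holPairing ζ θ = -conj (holPairing θ ζ) := by
  rw [holPairing_eq_cintegral_oneOneForm, holPairing_eq_cintegral_oneOneForm]
  have h : (⇑ζ * star ⇑θ : M → ℂ) = star (⇑θ * star ⇑ζ) := by
    funext x; simp [mul_comm]
  rw [h, oneOneForm_star, cintegral_neg, cintegral_conj]

/-- Additivity in the first argument. [cite: Forster1981, §19.5] -/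
theorem holPairing_add_left {θ θ' ζ : MeromorphicOneForm M} (hθ : θ.IsHolomorphic) (hθ' : θ'.IsHolomorphic)
    (hζ : ζ.IsHolomorphic) : holPairing (θ + θ') ζ = holPairing θ ζ + holPairing θ' ζ := by
  rw [holPairing_eq_cintegral_oneOneForm, holPairing_eq_cintegral_oneOneForm,
    holPairing_eq_cintegral_oneOneForm, MeromorphicOneForm.coe_add, add_mul, oneOneForm_add,
    cintegral_add_of_isSmoothForm (isSmoothForm_oneOneForm_mul_star hθ hζ)
      (isSmoothForm_oneOneForm_mul_star hθ' hζ)]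

/-- Homogeneity in the first argument. [cite: Forster1981, §19.5] -/
theorem holPairing_smul_left (c : ℂ) {θ ζ : MeromorphicOneForm M} (hθ : θ.IsHolomorphic)
    (hζ : ζ.IsHolomorphic) : holPairing (c • θ) ζ = c * holPairing θ ζ := by
  rw [holPairing_eq_cintegral_oneOneForm, holPairing_eq_cintegral_oneOneForm, MeromorphicOneForm.coe_smul,
    smul_mul_assoc, oneOneForm_smul, cintegral_smul_of_isSmoothForm c (isSmoothForm_oneOneForm_mul_star hθ hζ)]

/-- Additivity in the second argument. [cite: Forster1981, §19.5] -/
theorem holPairing_add_right {θ ζ ζ' : MeromorphicOneForm M} (hθ : θ.IsHolomorphic) (hζ : ζ.IsHolomorphic)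
    (hζ' : ζ'.IsHolomorphic) : holPairing θ (ζ + ζ') = holPairing θ ζ + holPairing θ ζ' := by
  rw [holPairing_eq_cintegral_oneOneForm, holPairing_eq_cintegral_oneOneForm,
    holPairing_eq_cintegral_oneOneForm, MeromorphicOneForm.coe_add, star_add, mul_add, oneOneForm_add,
    cintegral_add_of_isSmoothForm (isSmoothForm_oneOneForm_mul_star hθ hζ)
      (isSmoothForm_oneOneForm_mul_star hθ hζ')]

/-- Conjugate-homogeneity in the second argument. [cite: Forster1981, §19.5] -/
theorem holPairing_smul_right (c : ℂ) {θ ζ : MeromorphicOneForm M} (hθ : θ.IsHolomorphic)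
    (hζ : ζ.IsHolomorphic) : holPairing θ (c • ζ) = conj c * holPairing θ ζ := by
  rw [holPairing_eq_cintegral_oneOneForm, holPairing_eq_cintegral_oneOneForm, MeromorphicOneForm.coe_smul,
    star_smul, RCLike.star_def, mul_smul_comm, oneOneForm_smul,
    cintegral_smul_of_isSmoothForm _ (isSmoothForm_oneOneForm_mul_star hθ hζ)]

/-- **Riemann's inequality**: `Im ⟪θ, θ⟫ < 0` for a non-zero holomorphic `θ`
(`Re((i/2)⟪θ, θ⟫) = ∬ |f|² dx dy > 0`). [cite: Forster1981, §19.5] -/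
theorem im_holPairing_self_neg {θ : MeromorphicOneForm M} (hθ : θ.IsHolomorphic) (h0 : θ ≠ 0) :
    (holPairing θ θ).im < 0 := by
  have hpos := hθ.integral_normSq_pos h0
  have hs : IsSmoothForm ((oneZeroForm ⇑θ).wedge (zeroOneForm (star ⇑θ))) :=
    IsSmoothFormWedge_holds 𝓘(ℝ, ℂ) M ℂ hθ.isSmoothForm_oneZeroForm hθ.isSmoothForm_zeroOneForm_star
  rw [oneOneForm_I_half_mul_conj_eq, ← re_cintegral, cintegral_smul_of_isSmoothForm _ hs, ← holPairing_def]
    at hpos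
  have h : ((I / 2) * holPairing θ θ).re = -(holPairing θ θ).im / 2 := by
    simp [Complex.mul_re]; ring
  rw [h] at hpos
  linarith

/-- `⟪θ, θ⟫ ≠ 0` for `θ ≠ 0`. [cite: Forster1981, §19.5] -/
theorem holPairing_self_ne_zero {θ : MeromorphicOneForm M} (hθ : θ.IsHolomorphic) (h0 : θ ≠ 0) :
    holPairing θ θ ≠ 0 := fun h ↦ by
  have := im_holPairing_self_neg hθ h0
  rw [h, Complex.zero_im] at this
  exact lt_irrefl _ this

end PairingAlgebra

/-! ### §2 The Riesz isomorphism `Ω(M) ≃ ℂ^g` -/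

section Riesz

variable [ConnectedSpace M] [IsManifold 𝓘(ℂ, ℂ) ω M] [IsManifold 𝓘(ℝ, ℂ) ∞ M] [CompactSpace M]
  [T2Space M] [Fact (Module.finrank ℝ ℂ = 2)]
  {σ : Type*} [Fintype σ] [DecidableEq σ] (w : Module.Basis σ ℂ ↥(holomorphicOneForms M))

/-- The functional `⟪·, ζ⟫ ∈ Ω(M)^*` of a holomorphic differential `ζ`. [cite: Lange2023AbelianVarietiesComplex, §4.1.2] -/
def pairingFunctional (ζ : ↥(holomorphicOneForms M)) : Module.Dual ℂ ↥(holomorphicOneForms M) where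
  toFun θ := holPairing (θ : MeromorphicOneForm M) (ζ : MeromorphicOneForm M)
  map_add' θ θ' := by
    rw [Submodule.coe_add]; exact holPairing_add_left θ.2 θ'.2 ζ.2
  map_smul' c θ := by
    rw [Submodule.coe_smul, RingHom.id_apply, smul_eq_mul]; exact holPairing_smul_left c θ.2 ζ.2

omit [ConnectedSpace M] in
/-- `pairingFunctional ζ θ = ⟪θ, ζ⟫`. [cite: Lange2023AbelianVarietiesComplex, §4.1.2] -/
@[simp] theorem pairingFunctional_apply (ζ θ : ↥(holomorphicOneForms M)) :
    pairingFunctional ζ θ = holPairing (θ : MeromorphicOneForm M) (ζ : MeromorphicOneForm M) := rfl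

omit [ConnectedSpace M] in
/-- `⟪·, ζ + ζ'⟫ = ⟪·, ζ⟫ + ⟪·, ζ'⟫`. [cite: Lange2023AbelianVarietiesComplex, §4.1.2] -/
theorem pairingFunctional_add (ζ ζ' : ↥(holomorphicOneForms M)) :
    pairingFunctional (ζ + ζ') = pairingFunctional ζ + pairingFunctional ζ' := by
  ext θ
  rw [pairingFunctional_apply, LinearMap.add_apply, pairingFunctional_apply, pairingFunctional_apply,
    Submodule.coe_add]
  exact holPairing_add_right θ.2 ζ.2 ζ'.2

omit [ConnectedSpace M] in
/-- `⟪·, c ζ⟫ = c̄ ⟪·, ζ⟫`. [cite: Lange2023AbelianVarietiesComplex, §4.1.2] -/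
theorem pairingFunctional_smul (c : ℂ) (ζ : ↥(holomorphicOneForms M)) :
    pairingFunctional (c • ζ) = conj c • pairingFunctional ζ := by
  ext θ
  rw [pairingFunctional_apply, LinearMap.smul_apply, pairingFunctional_apply, Submodule.coe_smul,
    smul_eq_mul]
  exact holPairing_smul_right c θ.2 ζ.2

/-- **The Riesz map in coordinates**: `ζ ↦ (⟪w_j, ζ⟫)_j ∈ ℂ^g`, real-linear (conjugate-linear over `ℂ`).
[cite: Lange2023AbelianVarietiesComplex, §4.1.2] -/
def pairingCoords : ↥(holomorphicOneForms M) →ₗ[ℝ] (σ → ℂ) where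
  toFun ζ := dualCoords w (pairingFunctional ζ)
  map_add' ζ ζ' := by rw [pairingFunctional_add, map_add]
  map_smul' r ζ := by
    rw [RingHom.id_apply, ← Complex.coe_smul, pairingFunctional_smul, Complex.conj_ofReal, map_smul,
      Complex.coe_smul]

omit [ConnectedSpace M] in
/-- `pairingCoords w ζ = dualCoords w ⟪·, ζ⟫`. [cite: Lange2023AbelianVarietiesComplex, §4.1.2] -/
theorem pairingCoords_apply (ζ : ↥(holomorphicOneForms M)) :
    pairingCoords w ζ = dualCoords w (pairingFunctional ζ) := rfl

omit [ConnectedSpace M] in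
/-- Conjugate-linearity of the Riesz map. [cite: Lange2023AbelianVarietiesComplex, §4.1.2] -/
theorem pairingCoords_smul (c : ℂ) (ζ : ↥(holomorphicOneForms M)) :
    pairingCoords w (c • ζ) = conj c • pairingCoords w ζ := by
  rw [pairingCoords_apply, pairingCoords_apply, pairingFunctional_smul, map_smul]

omit [ConnectedSpace M] in
/-- **The Riesz map is injective** (Riemann's inequality: `⟪ζ, ζ⟫ ≠ 0` for `ζ ≠ 0`).
[cite: Forster1981, §19.5] [cite: Lange2023AbelianVarietiesComplex, §4.1.2] -/
theorem pairingCoords_injective : Injective (pairingCoords w) := by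
  intro ζ ζ' h
  rw [← sub_eq_zero] at h ⊢
  rw [← map_sub] at h
  set ξ := ζ - ζ' with hξ
  by_contra hne
  have hne' : (ξ : MeromorphicOneForm M) ≠ 0 := fun h0 ↦ hne (Subtype.ext h0)
  have h1 : pairingFunctional ξ = 0 := (dualCoords w).injective (by rw [← pairingCoords_apply, h, map_zero])
  have h2 : holPairing (ξ : MeromorphicOneForm M) (ξ : MeromorphicOneForm M) = 0 := by
    rw [← pairingFunctional_apply, h1, LinearMap.zero_apply]
  exact holPairing_self_ne_zero ξ.2 hne' h2

omit [ConnectedSpace M] [IsManifold 𝓘(ℂ, ℂ) ω M] [IsManifold 𝓘(ℝ, ℂ) ∞ M] [CompactSpace M] [T2Space M]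
  [Fact (Module.finrank ℝ ℂ = 2)] [DecidableEq σ] in
/-- `dim_ℝ Ω(M) = 2g = dim_ℝ ℂ^g`. [cite: Miranda1995, Chapter VIII §4] -/
theorem finrank_real_holomorphicOneForms_eq (w : Module.Basis σ ℂ ↥(holomorphicOneForms M)) :
    Module.finrank ℝ ↥(holomorphicOneForms M) = Module.finrank ℝ (σ → ℂ) := by
  rw [finrank_real_of_complex, Module.finrank_eq_card_basis w, Module.finrank_pi_fintype ℝ,
    Finset.sum_const, Finset.card_univ, Complex.finrank_real_complex, smul_eq_mul, mul_comm]

/-- **The Riesz isomorphism `Ω(M) ≃ ℂ^g`** (injective real-linear map between real vector spaces of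
the same dimension `2g`). [cite: Lange2023AbelianVarietiesComplex, §4.1.2] -/
def pairingEquiv : ↥(holomorphicOneForms M) ≃ₗ[ℝ] (σ → ℂ) :=
  haveI : Module.Finite ℂ ↥(holomorphicOneForms M) := moduleFinite_holomorphicOneForms
  (pairingCoords w).linearEquivOfInjective (pairingCoords_injective w) (finrank_real_holomorphicOneForms_eq w)

/-- `pairingEquiv w ζ = pairingCoords w ζ`. [cite: Lange2023AbelianVarietiesComplex, §4.1.2] -/
theorem pairingEquiv_apply (ζ : ↥(holomorphicOneForms M)) : pairingEquiv w ζ = pairingCoords w ζ := rfl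

/-- **The differential `ω_z` of a coordinate vector `z ∈ ℂ^g`**: the unique `ω ∈ Ω(M)` with
`(⟪w_j, ω⟫)_j = z`. [cite: Lange2023AbelianVarietiesComplex, §4.1.2] -/
def omegaOf (z : σ → ℂ) : ↥(holomorphicOneForms M) := (pairingEquiv w).symm z

/-- `pairingCoords w (ω_z) = z`. [cite: Lange2023AbelianVarietiesComplex, §4.1.2] -/
@[simp] theorem pairingCoords_omegaOf (z : σ → ℂ) : pairingCoords w (omegaOf w z) = z := by
  rw [← pairingEquiv_apply, omegaOf, LinearEquiv.apply_symm_apply]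

/-- **`⟪θ, ω_z⟫ = ((dualCoords w)⁻¹ z)(θ)`**. [cite: Lange2023AbelianVarietiesComplex, §4.1.2] -/
theorem holPairing_omegaOf (z : σ → ℂ) (θ : ↥(holomorphicOneForms M)) :
    holPairing (θ : MeromorphicOneForm M) (omegaOf w z : MeromorphicOneForm M) = (dualCoords w).symm z θ := by
  have h : pairingFunctional (omegaOf w z) = (dualCoords w).symm z := by
    rw [LinearEquiv.eq_symm_apply, ← pairingCoords_apply, pairingCoords_omegaOf]
  rw [← pairingFunctional_apply, h]

/-- `ω` is additive. [cite: Lange2023AbelianVarietiesComplex, §4.1.2] -/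
theorem omegaOf_add (z z' : σ → ℂ) : omegaOf w (z + z') = omegaOf w z + omegaOf w z' := by
  simp [omegaOf]

/-- `ω` is real-homogeneous. [cite: Lange2023AbelianVarietiesComplex, §4.1.2] -/
theorem omegaOf_smul_real (r : ℝ) (z : σ → ℂ) : omegaOf w (r • z) = r • omegaOf w z := by
  simp [omegaOf]

/-- **`ω` is conjugate-linear**: `ω_{c z} = c̄ ω_z`. [cite: Lange2023AbelianVarietiesComplex, §4.1.2] -/
theorem omegaOf_smul (c : ℂ) (z : σ → ℂ) : omegaOf w (c • z) = conj c • omegaOf w z := by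
  apply pairingCoords_injective w
  rw [pairingCoords_omegaOf, pairingCoords_smul, pairingCoords_omegaOf, Complex.conj_conj]

/-- `ω_z = 0 ↔ z = 0`. [cite: Lange2023AbelianVarietiesComplex, §4.1.2] -/
theorem omegaOf_eq_zero_iff (z : σ → ℂ) : omegaOf w z = 0 ↔ z = 0 := by
  rw [omegaOf, LinearEquiv.map_eq_zero_iff]

end Riesz

/-! ### §3 The Riemann form of the Jacobian -/

section RiemannForm

variable [ConnectedSpace M] [IsManifold 𝓘(ℂ, ℂ) ω M] [IsManifold 𝓘(ℝ, ℂ) ∞ M] [CompactSpace M]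
  [T2Space M] [Fact (Module.finrank ℝ ℂ = 2)]
  {σ : Type*} [Fintype σ] [DecidableEq σ] (w : Module.Basis σ ℂ ↥(holomorphicOneForms M))

/-- The real bilinear form `B(z, z') = (C/2) Re ⟪ω_{z'}, ω_z⟫` on `ℂ^g`. [cite: Lange2023AbelianVarietiesComplex, §4.1.2 Proposition 4.1.2] -/
def jacobianBilin : LinearMap.BilinForm ℝ (σ → ℂ) :=
  LinearMap.mk₂ ℝ
    (fun z z' ↦ (chartIntegralConst / 2) *
      (holPairing (omegaOf w z' : MeromorphicOneForm M) (omegaOf w z : MeromorphicOneForm M)).re)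
    (fun z₁ z₂ z' ↦ by
      rw [omegaOf_add, Submodule.coe_add, holPairing_add_right (omegaOf w z').2 (omegaOf w z₁).2 (omegaOf w z₂).2,
        Complex.add_re, mul_add])
    (fun r z z' ↦ by
      rw [omegaOf_smul_real, ← Complex.coe_smul, Submodule.coe_smul,
        holPairing_smul_right _ (omegaOf w z').2 (omegaOf w z).2, Complex.conj_ofReal, Complex.re_ofReal_mul,
        smul_eq_mul]
      ring)
    (fun z z₁ z₂ ↦ by
      rw [omegaOf_add, Submodule.coe_add, holPairing_add_left (omegaOf w z₁).2 (omegaOf w z₂).2 (omegaOf w z).2,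
        Complex.add_re, mul_add])
    (fun r z z' ↦ by
      rw [omegaOf_smul_real, ← Complex.coe_smul, Submodule.coe_smul,
        holPairing_smul_left _ (omegaOf w z').2 (omegaOf w z).2, Complex.re_ofReal_mul, smul_eq_mul]
      ring)

/-- `jacobianBilin w z z' = (C/2) Re ⟪ω_{z'}, ω_z⟫`. [cite: Lange2023AbelianVarietiesComplex, §4.1.2 Proposition 4.1.2] -/
@[simp] theorem jacobianBilin_apply (z z' : σ → ℂ) :
    jacobianBilin w z z' = (chartIntegralConst / 2) *
      (holPairing (omegaOf w z' : MeromorphicOneForm M) (omegaOf w z : MeromorphicOneForm M)).re := rfl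

/-- The same as a continuous bilinear map (finite dimension). [cite: Lange2023AbelianVarietiesComplex, §4.1.2 Proposition 4.1.2] -/
def jacobianBilinCLM : (σ → ℂ) →L[ℝ] (σ → ℂ) →L[ℝ] ℝ :=
  LinearMap.toContinuousLinearMap
    ((LinearMap.toContinuousLinearMap : ((σ → ℂ) →ₗ[ℝ] ℝ) ≃ₗ[ℝ] ((σ → ℂ) →L[ℝ] ℝ)).toLinearMap ∘ₗ
      jacobianBilin w)

/-- `jacobianBilinCLM w z z' = (C/2) Re ⟪ω_{z'}, ω_z⟫`. [cite: Lange2023AbelianVarietiesComplex, §4.1.2 Proposition 4.1.2] -/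
@[simp] theorem jacobianBilinCLM_apply (z z' : σ → ℂ) :
    jacobianBilinCLM w z z' = (chartIntegralConst / 2) *
      (holPairing (omegaOf w z' : MeromorphicOneForm M) (omegaOf w z : MeromorphicOneForm M)).re := rfl

/-- **The Riemann form of the Jacobian** in the coordinates `ℂ^g ≅ Ω(M)^*` of the basis `w`:
`E(z, z') = C · Re ⟪ω_{z'}, ω_z⟫` (the imaginary part of the canonical Hermitian form, up to the tree's
normalisation constant `C = chartIntegralConst > 0`). [cite: Lange2023AbelianVarietiesComplex, §4.1.2 Proposition 4.1.2] -/
def jacobianRiemannForm : (σ → ℂ) [⋀^Fin 2]→L[ℝ] ℝ := realTwoForm (jacobianBilinCLM w)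

/-- `E(z, z') = C · Re ⟪ω_{z'}, ω_z⟫` (the antisymmetrisation of `B` is `2B` by the skew-Hermitian
symmetry of `⟪·, ·⟫`). [cite: Lange2023AbelianVarietiesComplex, §4.1.2 Proposition 4.1.2] -/
theorem jacobianRiemannForm_apply (z z' : σ → ℂ) :
    jacobianRiemannForm w ![z, z'] = chartIntegralConst *
      (holPairing (omegaOf w z' : MeromorphicOneForm M) (omegaOf w z : MeromorphicOneForm M)).re := by
  rw [jacobianRiemannForm, realTwoForm_apply, jacobianBilinCLM_apply, jacobianBilinCLM_apply,
    holPairing_swap (omegaOf w z' : MeromorphicOneForm M) (omegaOf w z : MeromorphicOneForm M),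
    Complex.neg_re, Complex.conj_re]
  ring

/-- **Type `(1,1)`**: `E(iz, iz') = E(z, z')` (`ω_{iz} = -i ω_z` and `⟪-iθ, -iζ⟫ = ⟪θ, ζ⟫`).
[cite: Lange2023AbelianVarietiesComplex, §4.1.2 Proposition 4.1.2 and §2.1 Lemma 2.1.7] -/
theorem jacobianRiemannForm_I_smul (z z' : σ → ℂ) :
    jacobianRiemannForm w ![I • z, I • z'] = jacobianRiemannForm w ![z, z'] := by
  have h1 : ((starRingEnd ℂ) I • (omegaOf w z : MeromorphicOneForm M)).IsHolomorphic :=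
    ((starRingEnd ℂ) I • omegaOf w z).2
  rw [jacobianRiemannForm_apply, jacobianRiemannForm_apply, omegaOf_smul, omegaOf_smul, Submodule.coe_smul,
    Submodule.coe_smul, holPairing_smul_left _ (omegaOf w z').2 h1,
    holPairing_smul_right _ (omegaOf w z').2 (omegaOf w z).2, Complex.conj_conj,
    Complex.conj_I, ← mul_assoc, neg_mul, I_mul_I, neg_neg, one_mul]

/-- **Positivity**: `E(iz, z) = -C · Im ⟪ω_z, ω_z⟫ > 0` for `z ≠ 0` (Riemann's inequality).
[cite: Lange2023AbelianVarietiesComplex, §4.1.2 Proposition 4.1.2] [cite: Forster1981, §19.5] -/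
theorem jacobianRiemannForm_pos {z : σ → ℂ} (hz : z ≠ 0) :
    0 < jacobianRiemannForm w ![I • z, z] := by
  have hω0 : (omegaOf w z : MeromorphicOneForm M) ≠ 0 := fun h ↦
    hz ((omegaOf_eq_zero_iff w z).1 (Subtype.ext h))
  have him := im_holPairing_self_neg (omegaOf w z).2 hω0
  rw [jacobianRiemannForm_apply, omegaOf_smul, Submodule.coe_smul,
    holPairing_smul_right _ (omegaOf w z).2 (omegaOf w z).2, Complex.conj_conj, Complex.mul_re, Complex.I_re,
    Complex.I_im, zero_mul, one_mul, zero_sub, mul_neg]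
  exact neg_pos.2 (mul_neg_of_pos_of_neg chartIntegralConst_pos him) |> fun h ↦ by linarith

variable (x₀ : M)

/-- **The differential of a period vector**: for a loop `γ`, `ω_{∫_γ} = -(2/C) η_γ` for a holomorphic
`η_γ` with `2 Re ∫_δ η_γ ∈ ℤ` for all loops `δ` and `⟪θ, η_γ⟫ = -(C/2) ∫_γ θ`
(`exists_holomorphicOneForm_holPairing_eq_period`). [cite: Lange2023AbelianVarietiesComplex, §4.1.2 Proposition 4.1.2] -/
theorem exists_omegaOf_dualCoords_periodFunctional (γ : FundamentalGroup M x₀) :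
    ∃ η : ↥(holomorphicOneForms M),
      omegaOf w (dualCoords w (periodFunctional x₀ γ)) = ((-(chartIntegralConst / 2))⁻¹ : ℝ) • η ∧
      (∀ θ : ↥(holomorphicOneForms M),
        holPairing (θ : MeromorphicOneForm M) (η : MeromorphicOneForm M) =
          -(chartIntegralConst / 2 : ℝ) * period x₀ (θ : MeromorphicOneForm M) γ) ∧
      ∀ δ : FundamentalGroup M x₀, ∃ n : ℤ, 2 * (period x₀ (η : MeromorphicOneForm M) δ).re = n := by
  obtain ⟨η, hη, hint⟩ := exists_holomorphicOneForm_holPairing_eq_period (x₀ := x₀) γ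
  refine ⟨η, ?_, hη, hint⟩
  set k : ℝ := -(chartIntegralConst / 2) with hk
  have hk0 : k ≠ 0 := by
    rw [hk]; exact neg_ne_zero.2 (div_ne_zero chartIntegralConst_pos.ne' two_ne_zero)
  have hF : pairingFunctional η = (k : ℂ) • periodFunctional x₀ γ := by
    ext θ
    rw [pairingFunctional_apply, LinearMap.smul_apply, periodFunctional_apply, smul_eq_mul, hk,
      Complex.ofReal_neg]
    exact hη θ
  apply pairingCoords_injective w
  rw [pairingCoords_omegaOf, ← Complex.coe_smul, pairingCoords_smul, Complex.conj_ofReal, pairingCoords_apply,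
    hF, map_smul, smul_smul, ← Complex.ofReal_mul, inv_mul_cancel₀ hk0, Complex.ofReal_one, one_smul]

variable {κ : Type*} [Fintype κ] (c : Module.Basis κ ℤ ↥(periods x₀))

omit [IsManifold 𝓘(ℝ, ℂ) ∞ M] [Fact (Module.finrank ℝ ℂ = 2)] in
/-- A lattice vector of `ℂ^g/Π ℤ^{2g}` is the coordinate vector of the period functional of a loop.
[cite: Miranda1995, Chapter VIII §4 Definition 4.9] -/
theorem exists_periodMatrix_intVec_eq (m : κ → ℤ) :
    ∃ γ : FundamentalGroup M x₀, periodMatrix x₀ w c (intVec m) = dualCoords w (periodFunctional x₀ γ) := by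
  have hmem : (dualCoords w).symm (periodMatrix x₀ w c (intVec m)) ∈ periods x₀ :=
    (mem_range_latticeVec_periodMatrix_iff x₀ w c _).1 ⟨m, rfl⟩
  obtain ⟨γ, hγ⟩ := mem_periods_iff.1 hmem
  exact ⟨γ, by rw [hγ, LinearEquiv.apply_symm_apply]⟩

/-- **Integrality on the period lattice**: `E(Π m, Π n) ∈ ℤ` — indeed `E(∫_γ, ∫_δ) = -2 Re ∫_γ η_δ`.
[cite: Lange2023AbelianVarietiesComplex, §4.1.2 Proposition 4.1.2] [cite: Forster1981, §21.7] -/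
theorem jacobianRiemannForm_periodMatrix_intVec (m n : κ → ℤ) :
    ∃ k : ℤ, jacobianRiemannForm w ![periodMatrix x₀ w c (intVec m), periodMatrix x₀ w c (intVec n)] = k := by
  obtain ⟨γ, hγ⟩ := exists_periodMatrix_intVec_eq w x₀ c m
  obtain ⟨δ, hδ⟩ := exists_periodMatrix_intVec_eq w x₀ c n
  obtain ⟨ηγ, hωγ, hpγ, -⟩ := exists_omegaOf_dualCoords_periodFunctional w x₀ γ
  obtain ⟨ηδ, hωδ, -, hintδ⟩ := exists_omegaOf_dualCoords_periodFunctional w x₀ δ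
  obtain ⟨N, hN⟩ := hintδ γ
  refine ⟨-N, ?_⟩
  set k : ℝ := -(chartIntegralConst / 2) with hk
  have hk0 : k ≠ 0 := by
    rw [hk]; exact neg_ne_zero.2 (div_ne_zero chartIntegralConst_pos.ne' two_ne_zero)
  have h1 : ((((k⁻¹ : ℝ) : ℂ) • (ηγ : MeromorphicOneForm M))).IsHolomorphic := (((k⁻¹ : ℝ) : ℂ) • ηγ).2
  rw [jacobianRiemannForm_apply, hγ, hδ, hωγ, hωδ, ← Complex.coe_smul, ← Complex.coe_smul, Submodule.coe_smul,
    Submodule.coe_smul, holPairing_smul_left _ ηδ.2 h1,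
    holPairing_smul_right _ ηδ.2 ηγ.2, Complex.conj_ofReal, hpγ ηδ, ← periodFunctional_apply]
  -- `C · (k⁻¹ k⁻¹ k) Re ∫_γ η_δ = -2 Re ∫_γ η_δ = -N`
  have h2 : (2 : ℝ) * (periodFunctional x₀ γ ηδ).re = N := by rw [periodFunctional_apply]; exact hN
  rw [show ((k⁻¹ : ℝ) : ℂ) * (((k⁻¹ : ℝ) : ℂ) * (-((chartIntegralConst / 2 : ℝ) : ℂ) * periodFunctional x₀ γ ηδ)) =
      ((k⁻¹ * (k⁻¹ * k) : ℝ) : ℂ) * periodFunctional x₀ γ ηδ by rw [hk]; push_cast; ring,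
    inv_mul_cancel₀ hk0, mul_one, Complex.re_ofReal_mul, hk, Int.cast_neg, ← h2]
  have hC : chartIntegralConst ≠ 0 := chartIntegralConst_pos.ne'
  field_simp

/-- **The canonical polarization of the Jacobian**: `E` is a Riemann form for the complex torus
`ℂ^g/Π ℤ^{2g} ≅ Jac(M)`. [cite: Lange2023AbelianVarietiesComplex, §4.1.2 Proposition 4.1.2] -/
theorem isRiemannForm_jacobianRiemannForm :
    IsRiemannForm (periodMatrix x₀ w c) (jacobianRiemannForm w) :=
  ⟨jacobianRiemannForm_I_smul w, jacobianRiemannForm_periodMatrix_intVec w x₀ c,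
    fun _ hz ↦ jacobianRiemannForm_pos w hz⟩

/-- **The Jacobian of a compact connected Riemann surface is an abelian variety**: the complex torus
`ℂ^g/Π ℤ^{2g} ≅ Jac(M)` (`jacobianEquivComplexTorus`) admits a Riemann form.
[cite: Lange2023AbelianVarietiesComplex, §4.1.2 Proposition 4.1.2] [cite: Forster1981, §21.7] -/
theorem isAbelianVariety_jacobian : IsAbelianVariety (periodMatrix x₀ w c) :=
  ⟨jacobianRiemannForm w, isRiemannForm_jacobianRiemannForm w x₀ c⟩

/-- Basis-free form: for every compact connected Riemann surface there are a basis of `Ω(M)` and a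
`ℤ`-basis of the period lattice presenting `Jac(M)` as an abelian variety `ℂ^g/Π ℤ^{2g}`.
[cite: Lange2023AbelianVarietiesComplex, §4.1.2 Proposition 4.1.2] -/
theorem exists_isAbelianVariety_jacobian :
    ∃ P : (Fin (2 * arithGenus M) → ℝ) ≃L[ℝ] (Fin (arithGenus M) → ℂ),
      Nonempty (Jacobian x₀ ≃+ ComplexTorus P) ∧ IsAbelianVariety P := by
  classical
  haveI := moduleFree_int_periods x₀
  haveI := moduleFinite_int_periods x₀
  haveI : Module.Finite ℂ ↥(holomorphicOneForms M) := moduleFinite_holomorphicOneForms (M := M)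
  let c' := Module.finBasisOfFinrankEq ℤ ↥(periods x₀) (finrank_int_periods x₀)
  let w' := Module.finBasisOfFinrankEq ℂ ↥(holomorphicOneForms M)
    (finrank_holomorphicOneForms_eq_arithGenus (M := M))
  exact ⟨periodMatrix x₀ w' c', ⟨jacobianEquivComplexTorus x₀ w' c'⟩, isAbelianVariety_jacobian w' x₀ c'⟩

/-! ### §4 Corollaries -/

/-- **`Pic⁰(M)` is the group of points of an abelian variety**: `Pic⁰(M) ≃+ Jac(M) ≃+ ℂ^g/Π ℤ^{2g}`
(Abel–Jacobi, `PicardGroup.picZeroAddEquivJacobian`) with `ℂ^g/Π ℤ^{2g}` an abelian variety.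
[cite: Lange2023AbelianVarietiesComplex, §4.1.2 Proposition 4.1.2] [cite: Miranda1995, Chapter VIII §4] -/
theorem exists_kerDegree_addEquiv_abelianVariety :
    ∃ P : (Fin (2 * arithGenus M) → ℝ) ≃L[ℝ] (Fin (arithGenus M) → ℂ),
      Nonempty (↥(PicardGroup.degree M).ker ≃+ ComplexTorus P) ∧ IsAbelianVariety P := by
  obtain ⟨P, ⟨e⟩, hP⟩ := exists_isAbelianVariety_jacobian (M := M) (Classical.arbitrary M)
  exact ⟨P, ⟨(PicardGroup.picZeroAddEquivJacobian (Classical.arbitrary M)).trans e⟩, hP⟩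

omit [DecidableEq σ] in
/-- **Riemann's bilinear relation for the loop differentials**: if `⟪θ, η_γ⟫ = -(C/2) ∫_γ θ` and
`⟪θ, η_δ⟫ = -(C/2) ∫_δ θ` for all `θ ∈ Ω(M)`, then `∫_δ η_γ = -conj ∫_γ η_δ` (the skew-Hermitian
symmetry of `⟪·, ·⟫` read on the two loop differentials; in particular `Re ∫_δ η_γ = -Re ∫_γ η_δ`).
[cite: Forster1981, §21.7] [cite: Lange2023AbelianVarietiesComplex, §4.1.2 Proposition 4.1.2] -/
theorem period_eq_neg_conj_period_of_holPairing_eq {γ δ : FundamentalGroup M x₀}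
    {ηγ ηδ : ↥(holomorphicOneForms M)}
    (hγ : ∀ θ : ↥(holomorphicOneForms M),
      holPairing (θ : MeromorphicOneForm M) (ηγ : MeromorphicOneForm M) =
        -(chartIntegralConst / 2 : ℝ) * period x₀ (θ : MeromorphicOneForm M) γ)
    (hδ : ∀ θ : ↥(holomorphicOneForms M),
      holPairing (θ : MeromorphicOneForm M) (ηδ : MeromorphicOneForm M) =
        -(chartIntegralConst / 2 : ℝ) * period x₀ (θ : MeromorphicOneForm M) δ) :
    period x₀ (ηγ : MeromorphicOneForm M) δ = -conj (period x₀ (ηδ : MeromorphicOneForm M) γ) := by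
  have h1 := hδ ηγ
  have h2 := hγ ηδ
  have hsw := holPairing_swap (ηδ : MeromorphicOneForm M) (ηγ : MeromorphicOneForm M)
  rw [h1, h2, map_mul, map_neg, Complex.conj_ofReal] at hsw
  have hC : (-(chartIntegralConst / 2 : ℝ) : ℂ) ≠ 0 := by
    rw [neg_ne_zero, Ne, Complex.ofReal_eq_zero]
    exact div_ne_zero chartIntegralConst_pos.ne' two_ne_zero
  have h : (-(chartIntegralConst / 2 : ℝ) : ℂ) * period x₀ (ηγ : MeromorphicOneForm M) δ =
      (-(chartIntegralConst / 2 : ℝ) : ℂ) * -conj (period x₀ (ηδ : MeromorphicOneForm M) γ) := by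
    rw [hsw]; ring
  exact mul_left_cancel₀ hC h

/-- In particular `Re ∫_δ η_γ = -Re ∫_γ η_δ` for the loop differentials of
`exists_holomorphicOneForm_holPairing_eq_period`. [cite: Forster1981, §21.7] -/
theorem exists_loopDifferentials_re_period_symm (γ δ : FundamentalGroup M x₀) :
    ∃ ηγ ηδ : ↥(holomorphicOneForms M),
      (∀ θ : ↥(holomorphicOneForms M),
        holPairing (θ : MeromorphicOneForm M) (ηγ : MeromorphicOneForm M) =
          -(chartIntegralConst / 2 : ℝ) * period x₀ (θ : MeromorphicOneForm M) γ) ∧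
      (∀ θ : ↥(holomorphicOneForms M),
        holPairing (θ : MeromorphicOneForm M) (ηδ : MeromorphicOneForm M) =
          -(chartIntegralConst / 2 : ℝ) * period x₀ (θ : MeromorphicOneForm M) δ) ∧
      (period x₀ (ηγ : MeromorphicOneForm M) δ).re = -(period x₀ (ηδ : MeromorphicOneForm M) γ).re ∧
      ∃ n : ℤ, 2 * (period x₀ (ηγ : MeromorphicOneForm M) δ).re = n := by
  obtain ⟨ηγ, hγ, hintγ⟩ := exists_holomorphicOneForm_holPairing_eq_period (x₀ := x₀) γ
  obtain ⟨ηδ, hδ, -⟩ := exists_holomorphicOneForm_holPairing_eq_period (x₀ := x₀) δ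
  refine ⟨ηγ, ηδ, hγ, hδ, ?_, hintγ δ⟩
  have h := congrArg Complex.re (period_eq_neg_conj_period_of_holPairing_eq x₀ hγ hδ)
  rwa [Complex.neg_re, Complex.conj_re] at h

end RiemannForm

end RiemannSurface

end Literature.Geometry.Kaehler

end
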